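import Mathlib.Analysis.Complex.Polynomial.Basic
import Literature.AlgebraicGeometry.Frobenioids.ArchimedeanBasicProperties
import Literature.AlgebraicGeometry.Frobenioids.AngularFrobenioidsRelative
import Literature.AlgebraicGeometry.Frobenioids.ArchimedeanBaseComparison
import Literature.AlgebraicGeometry.Frobenioids.ArchimedeanDivisorMaximality
import HarnessLib

/-!
# Frobenioids II, Theorem 3.6 (ix) — PROVED for `C = C^ℤ`: `C^istr` is of strongly indissectible type

Mochizuki, *The geometry of Frobenioids II: poly-Frobenioids*, Kyushu J. Math. **62** (2008) 401–460,
§3, Theorem 3.6 (ix), kurims p. 38 [cite: MochizukiFrdII2008, Thm 3.6 (ix) p.38]: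

> (ix) Suppose that `D` is of strongly indissectible type. If `D` is not complexifiable, then we
> assume further that `Λ ≠ ℤ`. Then `F^istr` is of strongly indissectible type.

with the printed proof (p. 39): "Assertion (ix) follows, in light of the strong indissectibility
assumption on `D`, by reducing [cf. our assumption concerning the case when `D` is not
complexifiable] to the easily verified fact that the categories `(C^Λ_0)^istr[ℝ]` [when `Λ ≠ ℤ`],
`(C^Λ_0)^istr[ℂ]` [for arbitrary `Λ`] are of strongly indissectible type."

DISCHARGE of the generic predicate `ArchFrd.Thm36ix` (`ArchimedeanBasicProperties.lean`, seat
abc-iut-L1-t9) at the archimedean Frobenioid `C π = C₀ ×_{D₀} D` of Example 3.3 with `Λ = ℤ`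
(`AngularFrobenioidsRelative.lean`, seat abc-iut-L1-t6), over ANY base `π : D → D₀` (`D₀` read in
`ArchBase` through `D0.toArchBase`): DAG node `FrdII:Thm3.6(ix)`, PIECE 2 of abc-iut-L1-t9's split
(HOME/INBOX 2026-08-25T21:10:12Z). Since `Λ = ℤ`, the printed proviso forces `D` complexifiable.

**The proof written out (kernel-checked below).** Let `φ₀ : X₀ → A`, `φ₁ : X₁ → A` be arrows of
`C^istr` (so `X₀`, `X₁` are isotropic, i.e. — Example 3.3 (ii) — their angular regions are full
punctured discs). (1) Project to `D`: strong indissectibility of `D` (every object is NOT weakly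
dissectible) yields an object `b` and arrows `k₀ : b → (X₀)_D`, `k₁ : b → (X₁)_D` with
`k₀ ≫ (φ₀)_D = k₁ ≫ (φ₁)_D` (if some `(Xᵢ)_D` is initial this is immediate; otherwise it is the
negation of "weakly dissects"). (2) Complexifiability of `D` lets us assume `b` lies over `Spec ℂ`.
(3) Over `b` take the isotropic object `B` of tiny tip `t`; map it to `Xᵢ` with SWAPPED Frobenius
degrees (`deg ψ₀ = deg φ₁`, `deg ψ₁ = deg φ₀`, so both composites have degree `deg φ₀ · deg φ₁`),
scalar `1` towards `X₁` and, towards `X₀`, a `deg φ₀`-th root `s` in `ℂ^×` of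
`ι₀(c₀)⁻¹ · ι₁(c₁)` (`cᵢ` the scalar of `φᵢ`, `ιᵢ` the Galois twist of the base arrow `b → (Xᵢ)_D`);
then the two composites `B → A` have the same base arrow, the same degree and the same scalar
`ι₀(c₀) · s^{deg φ₀} = ι₁(c₁)`, hence coincide (`C₀`-arrows are determined by these data). For `t`
small (`t ≤ 1`, `|s|·t ≤ tip(X₀)`, `t ≤ tip(X₁)`) the region conditions hold because the `Xᵢ` are
discs. (4) `B` is isotropic and non-initial (it has the two distinct endomorphisms `(id, 1, 1)` and
`(id, 1, 1/2)`). Hence no pair of arrows weakly dissects `A`.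

**Status.** `thm36ix_C_of_isotropicIff` proves `Thm36ix (π ⋙ D0.toArchBase) (C.toElem π) ℤ`
GRANTED Example 3.3 (ii) "an object of `C` is isotropic if and only if it is naively isotropic" as the
hypothesis `hiso` (= abc-iut-L1-t6's named statement `Ex33ii_isotropic_iff π`, whose proof
`Ex33ii_isotropic_iff_holds` is staged in `ArchimedeanIsotropy.lean`); the unconditional
`thm36ix_C` is then the one-line specialisation, filed when that proof lands. Classical; no statement
of the paper is strengthened; theorems only (the witnesses `B`, `ψ₀`,
`ψ₁` are constructed inside the proof).
-/

namespace Literature.AlgebraicGeometry.Frobenioids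

open CategoryTheory CategoryTheory.Limits
open scoped Pointwise

universe v u

namespace ArchFrd

namespace Indissect

/-! ### Step (1): squares in a category of strongly indissectible type -/

section Base

variable {D : Type u} [Category.{v} D]

/-- In a category of strongly indissectible type, every pair of arrows `g₀ : Y₀ → a`, `g₁ : Y₁ → a`
can be completed to a commutative square `k₀ ≫ g₀ = k₁ ≫ g₁` (FrdII §0 p. 5: `a` is not weakly
dissectible; if some `Yᵢ` is an initial object the square is immediate).
[cite: MochizukiFrdII2008, Thm 3.6 (ix) p.38] -/
theorem exists_square (hD : IsOfStronglyIndissectibleType D) {a : D} (Y : Fin 2 → D)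
    (g : ∀ i, Y i ⟶ a) :
    ∃ (b : D) (k₀ : b ⟶ Y 0) (k₁ : b ⟶ Y 1), k₀ ≫ g 0 = k₁ ≫ g 1 := by
  by_contra hne
  push Not at hne
  apply hD.isStronglyIndissectible a
  refine ⟨Y, g, fun i => ⟨fun hI => ?_⟩, ?_⟩
  · obtain rfl | rfl : i = 0 ∨ i = 1 := (by omega)
    · exact hne (Y 0) (𝟙 _) (hI.to (Y 1)) (hI.hom_ext _ _)
    · exact hne (Y 1) (hI.to (Y 0)) (𝟙 _) (hI.hom_ext _ _)
  · intro i j hij B _ ψi ψj heq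
    obtain rfl | rfl : i = 0 ∨ i = 1 := (by omega)
    · obtain rfl | rfl : j = 0 ∨ j = 1 := (by omega)
      · exact hij rfl
      · exact hne B ψi ψj heq
    · obtain rfl | rfl : j = 0 ∨ j = 1 := (by omega)
      · exact hne B ψj ψi heq.symm
      · exact hij rfl

variable (π : D ⥤ D0)

/-- Step (2): over a complexifiable base the square of `exists_square` may be taken with complex
corner (compose with the complex object over a real one, FrdII Def. 3.1 (v)).
[cite: MochizukiFrdII2008, Thm 3.6 (ix) p.38] -/
theorem exists_complex_square (hD : IsOfStronglyIndissectibleType D)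
    (hcx : RC.IsComplexifiable (π ⋙ D0.toArchBase)) {a : D} (Y : Fin 2 → D) (g : ∀ i, Y i ⟶ a) :
    ∃ (b : D) (k₀ : b ⟶ Y 0) (k₁ : b ⟶ Y 1), (π.obj b).IsComplex ∧ k₀ ≫ g 0 = k₁ ≫ g 1 := by
  obtain ⟨b, k₀, k₁, hk⟩ := exists_square hD Y g
  rcases D0.isReal_or_isComplex (π.obj b) with hr | hc
  · obtain ⟨b', f, -, hc', -, -⟩ :=
      hcx.exists_complex b ((D0.realObjects_comp_iff π b).mpr hr)
    refine ⟨b', f ≫ k₀, f ≫ k₁, (D0.complexObjects_comp_iff π b').mp hc', ?_⟩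
    rw [Category.assoc, Category.assoc, hk]
  · exact ⟨b, k₀, k₁, hc, hk⟩

end Base

/-! ### Roots of units of `ℂ` -/

/-- Every unit of `ℂ` has an `n`-th root among the units (`n ≥ 1`; `ℂ` is algebraically closed).
[cite: MochizukiFrdII2008, Thm 3.6 (ix) p.38] -/
theorem exists_units_pow_eq (w : ℂˣ) {n : ℕ} (hn : 0 < n) : ∃ z : ℂˣ, z ^ n = w := by
  obtain ⟨z, hz⟩ := IsAlgClosed.exists_pow_nat_eq (w : ℂ) hn
  have hz0 : z ≠ 0 := by
    rintro rfl
    rw [zero_pow hn.ne'] at hz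
    exact w.ne_zero hz.symm
  exact ⟨Units.mk0 z hz0, Units.ext (by rw [Units.val_pow_eq_pow_val, Units.val_mk0, hz])⟩

/-! ### Step (4): every object of `C` is non-initial in any full subcategory -/

section Objects

variable {D : Type u} [Category.{v} D] (π : D ⥤ D0)

/-- Every object `B` of every full subcategory of `C` is non-initial: `B` has the two distinct
endomorphisms `(id, 1, 1)` and `(id, 1, 1/2)` over the identity of its `D`-component (the positive
real scaling `1/2` preserves the angular part and shrinks absolute values).
[cite: MochizukiFrdII2008, Thm 3.6 (ix) p.38] -/
theorem isNonemptyObj (P : ObjectProperty (C π)) (B : P.FullSubcategory) : IsNonemptyObj B := by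
  refine ⟨fun hI => ?_⟩
  let hf : PosReal := ⟨1 / 2, by norm_num⟩
  have h1 : hf ≤ 1 := by
    rw [← Subtype.coe_le_coe, Positive.val_one]; change (1 : ℝ) / 2 ≤ 1; norm_num
  -- the endomorphism `(id, 1, 1/2)`
  let e : B.obj ⟶ B.obj :=
    { fst :=
        { base := 𝟙 B.obj.fst.base, degFr := 1,
          scalar := ofPosReal ℂ hf, scalar_mem := ofPosReal_mem_scalars _ _,
          mapsTo := by
            change ofPosReal ℂ hf • B.obj.fst.region.carrier ^ ((1 : ℕ+) : ℕ) ⊆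
              C0.pullRegion B.obj.fst (𝟙 B.obj.fst.base)
            rw [PNat.one_coe, pow_one, C0.pullRegion_id]
            rintro _ ⟨u, hu, rfl⟩
            refine ⟨?_, ?_⟩
            · change unitPart ℂ (ofPosReal ℂ hf * u) ∈ _
              rw [unitPart_ofPosReal_mul]; exact hu.1
            · change absHom ℂ (ofPosReal ℂ hf * u) ≤ _
              rw [absHom_ofPosReal_mul]
              calc hf * absHom ℂ u ≤ 1 * absHom ℂ u := by gcongr
                _ = absHom ℂ u := one_mul _
                _ ≤ _ := hu.2 }
      snd := 𝟙 B.obj.snd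
      w := by
        change 𝟙 _ ≫ B.obj.iso.hom = B.obj.iso.hom ≫ π.map (𝟙 B.obj.snd)
        rw [CategoryTheory.Functor.map_id, Category.id_comp, Category.comp_id] }
  have hne : e ≠ 𝟙 B.obj := by
    intro h
    have h' := congrArg (fun f => ((C0.scalar (CFP.Hom.fst f) : ℂˣ) : ℂ)) h
    change ((ofPosReal ℂ hf : ℂˣ) : ℂ) = ((C0.scalar (𝟙 B.obj.fst) : ℂˣ) : ℂ) at h'
    rw [C0.scalar_id', coe_ofPosReal, Units.val_one] at h'
    have h'' := congrArg Complex.re h'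
    change ((1 : ℝ) / 2) = (1 : ℂ).re at h''
    norm_num at h''
  exact hne (congrArg InducedCategory.Hom.hom (hI.hom_ext (P.homMk e) (𝟙 B)))

/-! ### Step (3): arrows out of a small disc -/

variable {π}

/-- An element of `s · (disc of tip t)^{⊗m}` has absolute value at most `|s| · t^m`.
[cite: MochizukiFrdII2008, Ex 3.3 (i) p.28] -/
theorem norm_le_of_mem_smul_disc_pow (s : ℂˣ) (t : PosReal) (m : ℕ) {x : ℂˣ}
    (hx : x ∈ s • (AngularRegion.isotropicOfTip (K := ℂ) t).carrier ^ m) :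
    ‖(x : ℂ)‖ ≤ ‖(s : ℂ)‖ * (t : ℝ) ^ m := by
  obtain ⟨u, hu, rfl⟩ := Set.mem_smul_set.mp hx
  rw [smul_eq_mul, Units.val_mul, norm_mul]
  exact mul_le_mul_of_nonneg_left (norm_le_of_mem_carrier_pow _ m u hu) (norm_nonneg _)

/-- The region condition (c) of Example 3.3 (i) for an arrow `(e, m, s)` from the disc of tip `t` to an
object `X` of `C₀` with naively isotropic (= disc) region: it holds as soon as `|s| · t^m ≤ tip(X)`.
[cite: MochizukiFrdII2008, Thm 3.6 (ix) p.38] -/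
theorem smul_disc_pow_subset_pullRegion (X : C0) (hX : X.IsNaivelyIsotropic) {L : D0} (e : L ⟶ X.base)
    (t : PosReal) (m : ℕ) (s : ℂˣ) (hst : ‖(s : ℂ)‖ * (t : ℝ) ^ m ≤ (X.region.tip : ℝ)) :
    s • (AngularRegion.isotropicOfTip (K := ℂ) t).carrier ^ m ⊆ C0.pullRegion X e := by
  intro x hx
  have hxn := norm_le_of_mem_smul_disc_pow s t m hx
  change x ∈ D0.galAct (D0.Hom.twists e) '' X.region.carrier
  rw [C0.image_galAct_of_isIsotropic hX, C0.mem_carrier_of_isIsotropic hX,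
    ← Subtype.coe_le_coe, coe_absHom]
  exact hxn.trans hst

end Objects

/-! ### Theorem 3.6 (ix) for `C = C^ℤ` -/

section Main

variable {D : Type u} [Category.{v} D] (π : D ⥤ D0)

/-- **Theorem 3.6 (ix) for `C = C^ℤ`**, over any base `π : D → D₀`, GRANTED Example 3.3 (ii)
("an object of `C` is isotropic if and only if it is naively isotropic", hypothesis `hiso` — the
named statement `Ex33ii_isotropic_iff π` of seat abc-iut-L1-t6): if `D` is of strongly indissectible
type [and complexifiable — forced by the printed proviso since `Λ = ℤ`], then `C^istr` is of strongly
indissectible type. PROVED. [cite: MochizukiFrdII2008, Thm 3.6 (ix) p.38] -/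
theorem thm36ix_C_of_isotropicIff
    (hiso : ∀ X : C π, PreFrobenioid.IsIsotropic (C.toElem π) X ↔ X.fst.IsNaivelyIsotropic) :
    Thm36ix (π ⋙ D0.toArchBase) (C.toElem π) MonoidType.Z := by
  intro hD hΛ
  have hcx : RC.IsComplexifiable (π ⋙ D0.toArchBase) := by
    by_contra h
    exact hΛ h rfl
  let P := PreFrobenioid.isotropicObjects (C.toElem π)
  refine ⟨fun Ah => ?_⟩
  rintro ⟨X, φ, -, hsep⟩
  -- the data of the two arrows `φ i : X i → A`
  have hXi : ∀ i, (X i).obj.fst.IsNaivelyIsotropic := fun i => (hiso _).mp (X i).property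
  -- Steps (1)–(2): a complex square downstairs
  obtain ⟨b, k₀, k₁, hb, hk⟩ :=
    exists_complex_square π hD hcx (fun i => (X i).obj.snd) (fun i => (φ i).hom.snd)
  -- scalars: `s₁ = 1`, `s₀` a `d₀`-th root of `ι₀(c₀)⁻¹ · ι₁(c₁)`
  set d₀ : ℕ+ := C0.degFr (φ 0).hom.fst with hd₀
  set d₁ : ℕ+ := C0.degFr (φ 1).hom.fst with hd₁
  set e₀ : π.obj b ⟶ (X 0).obj.fst.base := π.map k₀ ≫ (X 0).obj.iso.inv with he₀
  set e₁ : π.obj b ⟶ (X 1).obj.fst.base := π.map k₁ ≫ (X 1).obj.iso.inv with he₁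
  set w : ℂˣ := (e₀.act (C0.scalar (φ 0).hom.fst))⁻¹ * e₁.act (C0.scalar (φ 1).hom.fst) with hw
  obtain ⟨s₀, hs₀⟩ := exists_units_pow_eq w d₀.pos
  have hsc : ∀ s : ℂˣ, s ∈ D0.scalars (π.obj b) := fun s => by
    rw [show π.obj b = D0.complex from hb, D0.scalars_complex]; exact Subgroup.mem_top _
  -- the tiny tip
  set t₀ : ℝ := ((X 0).obj.fst.region.tip : ℝ) with ht₀
  set t₁ : ℝ := ((X 1).obj.fst.region.tip : ℝ) with ht₁
  have ht₀pos : 0 < t₀ := (X 0).obj.fst.region.tip.2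
  have ht₁pos : 0 < t₁ := (X 1).obj.fst.region.tip.2
  set μ : ℝ := min 1 (min t₀ t₁) with hμ
  have hμpos : 0 < μ := lt_min one_pos (lt_min ht₀pos ht₁pos)
  have hμ1 : μ ≤ 1 := min_le_left _ _
  have hμ₀ : μ ≤ t₀ := (min_le_right _ _).trans (min_le_left _ _)
  have hμ₁ : μ ≤ t₁ := (min_le_right _ _).trans (min_le_right _ _)
  set N : ℝ := ‖(s₀ : ℂ)‖ + 1 with hN
  have hNpos : 0 < N := by positivity
  have hN1 : 1 ≤ N := by rw [hN]; linarith [norm_nonneg (s₀ : ℂ)]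
  let t : PosReal := ⟨μ / N, div_pos hμpos hNpos⟩
  have htμ : (t : ℝ) ≤ μ := div_le_self hμpos.le hN1
  have ht1 : (t : ℝ) ≤ 1 := htμ.trans hμ1
  have htpow : ∀ m : ℕ+, (t : ℝ) ^ (m : ℕ) ≤ (t : ℝ) :=
    fun m => pow_le_of_le_one t.2.le ht1 m.ne_zero
  have hst₀ : ‖(s₀ : ℂ)‖ * (t : ℝ) ^ (d₁ : ℕ) ≤ t₀ := by
    calc ‖(s₀ : ℂ)‖ * (t : ℝ) ^ (d₁ : ℕ) ≤ ‖(s₀ : ℂ)‖ * (t : ℝ) :=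
          mul_le_mul_of_nonneg_left (htpow d₁) (norm_nonneg _)
      _ = (‖(s₀ : ℂ)‖ / N) * μ := by change _ * (μ / N) = _; ring
      _ ≤ 1 * μ := by
          apply mul_le_mul_of_nonneg_right _ hμpos.le
          rw [div_le_one hNpos, hN]; linarith
      _ ≤ t₀ := by rw [one_mul]; exact hμ₀
  have hst₁ : ‖((1 : ℂˣ) : ℂ)‖ * (t : ℝ) ^ (d₀ : ℕ) ≤ t₁ := by
    rw [Units.val_one, norm_one, one_mul]
    exact (htpow d₀).trans (htμ.trans hμ₁)
  -- the refinement `B` (the disc of tip `t` over `b`) and the two arrows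
  let B : C π :=
    ⟨⟨π.obj b, AngularRegion.isotropicOfTip t, fun _ => AngularRegion.isIsotropic_isotropicOfTip _⟩,
      b, Iso.refl _⟩
  have hB : P B := (hiso B).mpr (AngularRegion.isIsotropic_isotropicOfTip _)
  let ψ₀ : B ⟶ (X 0).obj :=
    { fst :=
        { base := e₀, degFr := d₁, scalar := s₀, scalar_mem := hsc s₀,
          mapsTo := smul_disc_pow_subset_pullRegion (X 0).obj.fst (hXi 0) e₀ t d₁ s₀ hst₀ }
      snd := k₀
      w := by
        change (π.map k₀ ≫ (X 0).obj.iso.inv) ≫ (X 0).obj.iso.hom = 𝟙 _ ≫ π.map k₀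
        rw [Category.assoc, Iso.inv_hom_id, Category.comp_id, Category.id_comp] }
  let ψ₁ : B ⟶ (X 1).obj :=
    { fst :=
        { base := e₁, degFr := d₀, scalar := 1, scalar_mem := hsc 1,
          mapsTo := smul_disc_pow_subset_pullRegion (X 1).obj.fst (hXi 1) e₁ t d₀ 1 hst₁ }
      snd := k₁
      w := by
        change (π.map k₁ ≫ (X 1).obj.iso.inv) ≫ (X 1).obj.iso.hom = 𝟙 _ ≫ π.map k₁
        rw [Category.assoc, Iso.inv_hom_id, Category.comp_id, Category.id_comp] }
  have heq : ψ₀ ≫ (φ 0).hom = ψ₁ ≫ (φ 1).hom := by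
    refine CFP.hom_ext (C0.hom_ext ?_ ?_ ?_) ?_
    · -- base arrows: both are `π(kᵢ ≫ (φᵢ)_D) ≫ α_A⁻¹`
      have b0 : C0.Base (ψ₀ ≫ (φ 0).hom).fst = π.map (k₀ ≫ (φ 0).hom.snd) ≫ Ah.obj.iso.inv :=
        (Category.id_comp _).symm.trans (PreFrobenioid.FiberProduct.inv_comp_base (ψ₀ ≫ (φ 0).hom))
      have b1 : C0.Base (ψ₁ ≫ (φ 1).hom).fst = π.map (k₁ ≫ (φ 1).hom.snd) ≫ Ah.obj.iso.inv :=
        (Category.id_comp _).symm.trans (PreFrobenioid.FiberProduct.inv_comp_base (ψ₁ ≫ (φ 1).hom))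
      rw [b0, b1, hk]
    · -- Frobenius degrees
      rw [CFP.comp_fst, CFP.comp_fst, C0.degFr_comp', C0.degFr_comp']
      change d₁ * d₀ = d₀ * d₁
      exact mul_comm _ _
    · -- scalars
      rw [CFP.comp_fst, CFP.comp_fst, C0.scalar_comp', C0.scalar_comp']
      change e₀.act (C0.scalar (φ 0).hom.fst) * s₀ ^ (d₀ : ℕ) =
        e₁.act (C0.scalar (φ 1).hom.fst) * 1 ^ (d₁ : ℕ)
      rw [hs₀, hw, one_pow, mul_one, mul_inv_cancel_left]
    · -- `D`-components
      change k₀ ≫ (φ 0).hom.snd = k₁ ≫ (φ 1).hom.snd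
      exact hk
  -- contradiction with "weakly dissects"
  refine hsep (i := 0) (j := 1) (by decide) (isNonemptyObj π P ⟨B, hB⟩)
    (P.homMk ψ₀ : (⟨B, hB⟩ : P.FullSubcategory) ⟶ X 0) (P.homMk ψ₁) ?_
  exact InducedCategory.hom_ext heq

end Main

end Indissect

end ArchFrd

end Literature.AlgebraicGeometry.Frobenioids
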